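import Summits.NavierStokesRegularity.FunctionalMining.StrainMomentRegWeight
import HarnessLib

/-!
# FunctionalMining — the regularised `∫|S|^q` balance: `Ḟ_ε ≤ C M F_ε` under a vorticity majorant

Search for candidate a priori estimates; no regularity claim. Cell `pub-nsfunc`, prove seat (gen 13). Second of three
files proving `StrainMomentCZClosure` (NOGO N8 = K0-FLAGS A5) at `d = Fin 3`. Along a classical
solution of unforced Navier–Stokes/Euler (`ν ≥ 0`) on `T³ × [a, b]` with a UNIFORM pointwise
vorticity majorant `|ω(τ, x)|² ≤ M²` on the window, the regularised moment
`F_ε(s) = ∫ (|S(u s)|² + ε)^{q/2}` (`ε > 0`, real `q > 1`) has at every `τ` a one-sided derivative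
`D` within `[a, b]` with `D ≤ C · M · F_ε(τ)`, `C = q (K₃^{1/q} + (9^q C_P K₃)^{1/q})`
(`reg_hasDerivWithinAt_le`) — the SAME constant as the `q > 2` file:

* the `C¹` balance `Ḟ_ε = 2νV_ε − 2P_ε − 2N_ε` (tree
  `hasDerivWithinAt_integral_comp_strainSqAt_of_contDiffOn_one` with `Ψ_ε` on `Ioi (−ε)`);
* `V_ε ≤ 0` (`viscous_reg_nonpos`, previous file);
* `|Ψ_ε'(|S|²)·D| ≤ (q/2)(√(|S|²+ε))^{q−1}B` whenever `|D| ≤ |S|·B` (`abs_integral_reg_mul_le`),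
  Hölder, and the Calderón–Zygmund chain with the sup on ONE vorticity factor
  `∫|∇u|^{2q} ≤ K₃ M^q ∫|S|^q ≤ K₃ M^q F_ε` (`exists_gradMoment_le_sup_mul_of_one_lt`, every real
  `q > 1`), pressure Hessian in `L^q` (`exists_hess_rpow`, `9^q C_P`).

Existential constants (Calderón–Zygmund); static inputs all tree lemmas.
-/

noncomputable section

open MeasureTheory Finset Set Filter Topology
open scoped InnerProductSpace RealInnerProductSpace ContDiff

namespace Summit.NavierStokesRegularity.FunctionalMining

open Literature.Analysis.FunctionSpaces Literature.Analysis.FunctionSpaces.Torus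
  Literature.Analysis.FluidPDE

namespace StrainMoment

open StrainL4 VorticityL4

/-! ## 4. The productions of the regularised balance and `Ḟ_ε ≤ C M F_ε` -/

/-- **`∫|∇u|^{2q} ≤ K₃ M^q ∫|S|^q` for every real `q > 1`** (the `q > 2` statement of
`exists_gradMoment_le_sup_mul`, same proof: vorticity Calderón–Zygmund at `2q`, the sup once,
`|ω|² ≤ 2|∇u|²`, strain Calderón–Zygmund at `q`). [ours; NOGO N8] -/
theorem exists_gradMoment_le_sup_mul_of_one_lt {q : ℝ} (hq : 1 < q) :
    ∃ K₃ : ℝ, 0 ≤ K₃ ∧ ∀ v : UnitAddTorus (Fin 3) → EuclideanSpace ℝ (Fin 3), IsSmooth v →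
      IsDivFree v → ∀ M : ℝ, 0 ≤ M → (∀ x, torusVorticitySqAt v x ≤ M ^ 2) →
        ∫ x, (∑ k, ‖partialDeriv k v x‖ ^ 2) ^ q ≤
          K₃ * M ^ q * ∫ x, ‖strainFlat v x‖ ^ q := by
  obtain ⟨K₁, hK₁0, hK₁⟩ := VorticityMoment.exists_cz_rpow (q := q) (by linarith)
  obtain ⟨K₂, hK₂0, hK₂⟩ := exists_cz_rpow (q := q / 2) (by linarith)
  refine ⟨K₁ * (2 : ℝ) ^ (q / 2) * K₂, by positivity, fun v hv hdiv M hM hω => ?_⟩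
  have hq0 : 0 ≤ q := by linarith
  have hcq : Continuous fun x => ‖BDSV.curl v x‖ ^ q :=
    VorticityMoment.continuous_norm_curl_rpow hv hq0
  have hcg : Continuous fun x => (∑ k, ‖partialDeriv k v x‖ ^ 2) ^ (q / 2) :=
    (continuous_gradSq hv).rpow_const fun x => Or.inr (by linarith)
  have ha := hK₁ v hv hdiv
  have hb : ∫ x, ‖BDSV.curl v x‖ ^ (2 * q) ≤ M ^ q * ∫ x, ‖BDSV.curl v x‖ ^ q := by
    rw [← integral_const_mul]
    exact integral_mono_of_nonneg (ae_of_all _ fun x => Real.rpow_nonneg (norm_nonneg _) _)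
      (hcq.const_mul _ |>.integrable_unitAddTorus)
      (ae_of_all _ fun x => norm_curl_rpow_two_mul_le v x hM hq0 (hω x))
  have hc : ∫ x, ‖BDSV.curl v x‖ ^ q ≤
      (2 : ℝ) ^ (q / 2) * ∫ x, (∑ k, ‖partialDeriv k v x‖ ^ 2) ^ (q / 2) := by
    rw [← integral_const_mul]
    exact integral_mono_of_nonneg (ae_of_all _ fun x => Real.rpow_nonneg (norm_nonneg _) _)
      (hcg.const_mul _ |>.integrable_unitAddTorus)
      (ae_of_all _ fun x => norm_curl_rpow_le v x hq0)
  have hd : ∫ x, (∑ k, ‖partialDeriv k v x‖ ^ 2) ^ (q / 2) ≤ K₂ * ∫ x, ‖strainFlat v x‖ ^ q := by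
    have h := hK₂ v hv hdiv
    rw [show 2 * (q / 2) = q by ring] at h
    exact h
  have hMq : 0 ≤ M ^ q := Real.rpow_nonneg hM _
  have h2q : 0 ≤ (2 : ℝ) ^ (q / 2) := Real.rpow_nonneg (by norm_num) _
  calc ∫ x, (∑ k, ‖partialDeriv k v x‖ ^ 2) ^ q
      ≤ K₁ * ∫ x, ‖BDSV.curl v x‖ ^ (2 * q) := ha
    _ ≤ K₁ * (M ^ q * ∫ x, ‖BDSV.curl v x‖ ^ q) := mul_le_mul_of_nonneg_left hb hK₁0
    _ ≤ K₁ * (M ^ q * ((2 : ℝ) ^ (q / 2) * ∫ x, (∑ k, ‖partialDeriv k v x‖ ^ 2) ^ (q / 2))) :=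
        mul_le_mul_of_nonneg_left (mul_le_mul_of_nonneg_left hc hMq) hK₁0
    _ ≤ K₁ * (M ^ q * ((2 : ℝ) ^ (q / 2) * (K₂ * ∫ x, ‖strainFlat v x‖ ^ q))) :=
        mul_le_mul_of_nonneg_left (mul_le_mul_of_nonneg_left
          (mul_le_mul_of_nonneg_left hd h2q) hMq) hK₁0
    _ = K₁ * (2 : ℝ) ^ (q / 2) * K₂ * M ^ q * ∫ x, ‖strainFlat v x‖ ^ q := by ring

/-- `(√(y + ε))^r = (y + ε)^{r/2}` for `y + ε ≥ 0`. [folklore] -/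
theorem sqrt_rpow_eq {z r : ℝ} (hz : 0 ≤ z) : Real.sqrt z ^ r = z ^ (r / 2) := by
  rw [Real.sqrt_eq_rpow, ← Real.rpow_mul hz]
  congr 1; ring

/-- **Productions against the regularised weight.** If `|D(x)| ≤ √(|S|²(x)) B(x)` pointwise with
`B ≥ 0` continuous, then for `ε > 0` and real `q ≥ 0`,
`|∫ Ψ_ε'(|S|²) D| ≤ (q/2) ∫ (√(|S|²+ε))^{q−1} B` (`Ψ_ε'(y)√y ≤ (q/2)(y+ε)^{(q−1)/2}`). [ours] -/
theorem abs_integral_reg_mul_le {d : Type*} [Fintype d] [DecidableEq d]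
    {v : UnitAddTorus d → EuclideanSpace ℝ d} (hv : IsSmooth v)
    {D B : UnitAddTorus d → ℝ} (hB : Continuous B) (hB0 : ∀ x, 0 ≤ B x)
    (hDB : ∀ x, |D x| ≤ Real.sqrt (torusStrainSqAt v x) * B x) {ε q : ℝ} (hε : 0 < ε) (hq : 0 ≤ q) :
    |∫ x, deriv (fun y : ℝ => (y + ε) ^ (q / 2)) (torusStrainSqAt v x) * D x| ≤
      q / 2 * ∫ x, Real.sqrt (torusStrainSqAt v x + ε) ^ (q - 1) * B x := by
  have hQ0 : ∀ x, 0 ≤ torusStrainSqAt v x := torusStrainSqAt_nonneg v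
  have hpos : ∀ x, 0 < torusStrainSqAt v x + ε := fun x => by linarith [hQ0 x]
  have hpt : ∀ x, |deriv (fun y : ℝ => (y + ε) ^ (q / 2)) (torusStrainSqAt v x) * D x| ≤
      q / 2 * (Real.sqrt (torusStrainSqAt v x + ε) ^ (q - 1) * B x) := by
    intro x
    rw [deriv_rpow_add (hpos x)]
    set y := torusStrainSqAt v x with hy
    have hw0 : 0 ≤ q / 2 * (y + ε) ^ (q / 2 - 1) := mul_nonneg (by linarith) (Real.rpow_nonneg (hpos x).le _)
    rw [abs_mul, abs_of_nonneg hw0]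
    have h1 : Real.sqrt y ≤ Real.sqrt (y + ε) := Real.sqrt_le_sqrt (by linarith)
    have h2 : (y + ε) ^ (q / 2 - 1) * Real.sqrt (y + ε) = Real.sqrt (y + ε) ^ (q - 1) := by
      rw [sqrt_rpow_eq (hpos x).le, Real.sqrt_eq_rpow, ← Real.rpow_add (hpos x)]
      congr 1; ring
    calc q / 2 * (y + ε) ^ (q / 2 - 1) * |D x|
        ≤ q / 2 * (y + ε) ^ (q / 2 - 1) * (Real.sqrt y * B x) := mul_le_mul_of_nonneg_left (hDB x) hw0
      _ ≤ q / 2 * (y + ε) ^ (q / 2 - 1) * (Real.sqrt (y + ε) * B x) :=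
          mul_le_mul_of_nonneg_left (mul_le_mul_of_nonneg_right h1 (hB0 x)) hw0
      _ = q / 2 * (((y + ε) ^ (q / 2 - 1) * Real.sqrt (y + ε)) * B x) := by ring
      _ = q / 2 * (Real.sqrt (y + ε) ^ (q - 1) * B x) := by rw [h2]
  have hc : Continuous fun x => q / 2 * (Real.sqrt (torusStrainSqAt v x + ε) ^ (q - 1) * B x) := by
    refine continuous_const.mul ((Continuous.rpow_const ?_ fun x => Or.inl ?_).mul hB)
    · exact ((continuous_strainSqAt hv).add continuous_const).sqrt
    · exact (Real.sqrt_pos.2 (hpos x)).ne'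
  calc |∫ x, deriv (fun y : ℝ => (y + ε) ^ (q / 2)) (torusStrainSqAt v x) * D x|
      ≤ ∫ x, |deriv (fun y : ℝ => (y + ε) ^ (q / 2)) (torusStrainSqAt v x) * D x| :=
        abs_integral_le_integral_abs
    _ ≤ ∫ x, q / 2 * (Real.sqrt (torusStrainSqAt v x + ε) ^ (q - 1) * B x) :=
        integral_mono_of_nonneg (ae_of_all _ fun x => abs_nonneg _) hc.integrable_unitAddTorus
          (ae_of_all _ hpt)
    _ = q / 2 * ∫ x, Real.sqrt (torusStrainSqAt v x + ε) ^ (q - 1) * B x := integral_const_mul _ _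

/-- **`Ḟ_ε ≤ C M F_ε` on a window with a uniform vorticity majorant.** Along a classical solution of
unforced Navier–Stokes/Euler (`ν ≥ 0`) on `T³ × [a, b]` with `|ω(τ,x)|² ≤ M²` for ALL `τ ∈ [a, b]`
and all `x`, the regularised moment `F_ε(s) = ∫(|S(u s)|²+ε)^{q/2}` (`ε > 0`, real `q > 1`) has at
every `τ ∈ [a, b]` a one-sided derivative `D` within `[a, b]` with `D ≤ C M F_ε(τ)`,
`C = q (K₃^{1/q} + (9^q C_P K₃)^{1/q})` (`K₃` a constant of `exists_gradMoment_le_sup_mul_of_one_lt`,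
`C_P` a pressure-Hessian Calderón–Zygmund constant at `q`). [ours; NOGO N8 regularised] -/
theorem reg_hasDerivWithinAt_le {q : ℝ} (hq : 1 < q) {K₃ CP : ℝ} (hK₃0 : 0 ≤ K₃)
    (hK₃ : ∀ v : UnitAddTorus (Fin 3) → EuclideanSpace ℝ (Fin 3), IsSmooth v →
      IsDivFree v → ∀ M : ℝ, 0 ≤ M → (∀ x, torusVorticitySqAt v x ≤ M ^ 2) →
        ∫ x, (∑ k, ‖partialDeriv k v x‖ ^ 2) ^ q ≤ K₃ * M ^ q * ∫ x, ‖strainFlat v x‖ ^ q)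
    (hCP0 : 0 ≤ CP) {a b ν : ℝ} (hab : a < b) (hν : 0 ≤ ν)
    {u : ℝ → UnitAddTorus (Fin 3) → EuclideanSpace ℝ (Fin 3)} {p : ℝ → UnitAddTorus (Fin 3) → ℝ}
    (hsol : IsClassicalNSSolutionOn (Icc a b) ν 0 u p)
    (hCP : ∀ t ∈ Icc a b, ∀ i j : Fin 3,
      ∫ x, |partialDeriv i (partialDeriv j (p t)) x| ^ q ≤
        CP * ∫ x, (∑ k, ‖partialDeriv k (u t) x‖ ^ 2) ^ q)
    {M : ℝ} (hM : 0 ≤ M) (hω : ∀ τ ∈ Icc a b, ∀ x, torusVorticitySqAt (u τ) x ≤ M ^ 2)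
    {ε : ℝ} (hε : 0 < ε) {τ : ℝ} (hτ : τ ∈ Icc a b) :
    ∃ D : ℝ, HasDerivWithinAt (fun s => ∫ x, (torusStrainSqAt (u s) x + ε) ^ (q / 2)) D (Icc a b) τ ∧
      D ≤ q * (K₃ ^ (1 / q) + ((9 : ℝ) ^ q * CP * K₃) ^ (1 / q)) * M *
        ∫ x, (torusStrainSqAt (u τ) x + ε) ^ (q / 2) := by
  have hq0 : 0 < q := by linarith
  have hq1 : (1 : ℝ) ≤ q := hq.le
  have hut : IsSmooth (u τ) := hsol.smooth_velocity.isSmooth_slice hτ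
  have hdiv : IsDivFree (u τ) := hsol.divFree τ hτ
  have hpt : IsSmooth (p τ) := hsol.smooth_pressure.isSmooth_slice hτ
  have hQ0 : ∀ s x, 0 ≤ torusStrainSqAt (u s) x := fun s x => torusStrainSqAt_nonneg _ _
  have hmaps : ∀ s ∈ Icc a b, ∀ x, torusStrainSqAt (u s) x ∈ Ioi (-ε) := fun s _ x => by
    show -ε < torusStrainSqAt (u s) x; linarith [hQ0 s x]
  have hΨ1 : ContDiffOn ℝ 1 (fun y : ℝ => (y + ε) ^ (q / 2)) (Ioi (-ε)) := contDiffOn_rpow_add ε _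
  have hD := GradientTensor.hasDerivWithinAt_integral_comp_strainSqAt_of_contDiffOn_one hsol hab
    isOpen_Ioi hΨ1 hmaps hτ
  refine ⟨_, hD, ?_⟩
  -- the forcing term vanishes
  have h0 : ∀ x, ∑ i, ∑ j,
      (partialDeriv j (u τ) x i + partialDeriv i (u τ) x j) / 2 *
        partialDeriv i ((0 : ℝ → UnitAddTorus (Fin 3) → EuclideanSpace ℝ (Fin 3)) τ) x j = 0 := by
    intro x
    have h0' : ∀ i, partialDeriv i (0 : UnitAddTorus (Fin 3) → EuclideanSpace ℝ (Fin 3)) x = 0 := by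
      intro i
      simp [Torus.partialDeriv, Torus.lineDeriv]
    simp [h0']
  simp only [h0, mul_zero, integral_zero, add_zero]
  -- names
  obtain ⟨V, hV⟩ : ∃ V : ℝ, V = ∫ x, deriv (fun y : ℝ => (y + ε) ^ (q / 2)) (torusStrainSqAt (u τ) x) *
      ∑ i, ∑ j, (partialDeriv j (u τ) x i + partialDeriv i (u τ) x j) / 2 *
        partialDeriv i (Torus.laplacian (u τ)) x j := ⟨_, rfl⟩
  obtain ⟨P, hP⟩ : ∃ P : ℝ, P = ∫ x, deriv (fun y : ℝ => (y + ε) ^ (q / 2)) (torusStrainSqAt (u τ) x) *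
      ∑ i, ∑ j, (partialDeriv j (u τ) x i + partialDeriv i (u τ) x j) / 2 *
        partialDeriv i (partialDeriv j (p τ)) x := ⟨_, rfl⟩
  obtain ⟨N, hN⟩ : ∃ N : ℝ, N = ∫ x, deriv (fun y : ℝ => (y + ε) ^ (q / 2)) (torusStrainSqAt (u τ) x) *
      ∑ i, ∑ j, (partialDeriv j (u τ) x i + partialDeriv i (u τ) x j) / 2 *
        ∑ k, partialDeriv i (u τ) x k * partialDeriv k (u τ) x j := ⟨_, rfl⟩
  obtain ⟨Fε, hFε⟩ : ∃ F : ℝ, F = ∫ x, (torusStrainSqAt (u τ) x + ε) ^ (q / 2) := ⟨_, rfl⟩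
  obtain ⟨G, hG⟩ : ∃ G : ℝ, G = ∫ x, (∑ k, ‖partialDeriv k (u τ) x‖ ^ 2) ^ q := ⟨_, rfl⟩
  obtain ⟨Hq, hHq⟩ : ∃ H : ℝ, H = ∫ x, (∑ i, ∑ j, |partialDeriv i (partialDeriv j (p τ)) x|) ^ q :=
    ⟨_, rfl⟩
  rw [← hV, ← hP, ← hN, ← hFε]
  -- the regularised density `φ_ε = √(|S|² + ε)` and `∫ φ_ε^q = F_ε`
  have hφc : Continuous fun x => Real.sqrt (torusStrainSqAt (u τ) x + ε) :=
    ((continuous_strainSqAt hut).add continuous_const).sqrt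
  have hφq : ∫ x, Real.sqrt (torusStrainSqAt (u τ) x + ε) ^ q = Fε := by
    rw [hFε]
    exact integral_congr_ae (ae_of_all _ fun x => by
      show Real.sqrt (torusStrainSqAt (u τ) x + ε) ^ q = (torusStrainSqAt (u τ) x + ε) ^ (q / 2)
      exact sqrt_rpow_eq (by linarith [hQ0 τ x]))
  have hg0 : ∀ x, 0 ≤ ∑ k, ‖partialDeriv k (u τ) x‖ ^ 2 := fun x =>
    Finset.sum_nonneg fun k _ => sq_nonneg _
  have hh0 : ∀ x, 0 ≤ ∑ i, ∑ j, |partialDeriv i (partialDeriv j (p τ)) x| := fun x =>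
    Finset.sum_nonneg fun i _ => Finset.sum_nonneg fun j _ => abs_nonneg _
  have hFε0 : 0 ≤ Fε := by rw [hFε]; exact integral_nonneg fun x => Real.rpow_nonneg (by linarith [hQ0 τ x]) _
  have hG0 : 0 ≤ G := by rw [hG]; exact integral_nonneg fun x => Real.rpow_nonneg (hg0 x) _
  have hHq0 : 0 ≤ Hq := by rw [hHq]; exact integral_nonneg fun x => Real.rpow_nonneg (hh0 x) _
  -- (i) `G ≤ K₃ M^q ∫φ^q ≤ K₃ M^q F_ε`
  have hφle : ∫ x, ‖strainFlat (u τ) x‖ ^ q ≤ Fε := by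
    rw [← hφq]
    refine integral_mono_of_nonneg (ae_of_all _ fun x => Real.rpow_nonneg (norm_nonneg _) _)
      ((hφc.rpow_const fun x => Or.inr hq0.le).integrable_unitAddTorus) (ae_of_all _ fun x => ?_)
    show ‖strainFlat (u τ) x‖ ^ q ≤ Real.sqrt (torusStrainSqAt (u τ) x + ε) ^ q
    rw [norm_strainFlat_eq_sqrt]
    exact Real.rpow_le_rpow (Real.sqrt_nonneg _) (Real.sqrt_le_sqrt (by linarith)) hq0.le
  have hGle : G ≤ K₃ * M ^ q * Fε := by
    have h1 : G ≤ K₃ * M ^ q * ∫ x, ‖strainFlat (u τ) x‖ ^ q := by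
      rw [hG]; exact hK₃ (u τ) hut hdiv M hM (hω τ hτ)
    exact h1.trans (mul_le_mul_of_nonneg_left hφle (mul_nonneg hK₃0 (Real.rpow_nonneg hM _)))
  -- (ii) `|N| ≤ (q/2) K₃^{1/q} M F_ε`
  have hNle : |N| ≤ q / 2 * (K₃ ^ (1 / q) * M * Fε) := by
    have h := abs_integral_reg_mul_le hut (continuous_gradSq hut) hg0 (abs_nonlinearDensity_le (u τ))
      hε hq0.le
    rw [← hN] at h
    have h' := integral_rpow_mul_le_holder hφc (continuous_gradSq hut) (fun x => Real.sqrt_nonneg _)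
      hg0 hq
    rw [hφq, ← hG] at h'
    have h'' := holder_sup_chain hFε0 hG0 hK₃0 hM hq0 h' hGle
    exact h.trans (mul_le_mul_of_nonneg_left h'' (by linarith))
  -- (iii) `∫h^q ≤ 9^q C_P G` and `|P| ≤ (q/2) (9^q C_P K₃)^{1/q} M F_ε`
  have hHle : Hq ≤ (9 : ℝ) ^ q * CP * K₃ * M ^ q * Fε := by
    have hH := integral_sum_abs_rpow_le (d := Fin 3)
      (H := fun i j x => partialDeriv i (partialDeriv j (p τ)) x)
      (fun i j => ((hpt.partialDeriv j).partialDeriv i).continuous) hq1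
    simp only [Fintype.card_fin, Nat.cast_ofNat] at hH
    have hsum : ∑ i : Fin 3, ∑ j : Fin 3, ∫ x, |partialDeriv i (partialDeriv j (p τ)) x| ^ q ≤
        ∑ i : Fin 3, ∑ j : Fin 3, CP * G := by
      refine Finset.sum_le_sum fun i _ => Finset.sum_le_sum fun j _ => ?_
      rw [hG]; exact hCP τ hτ i j
    have hsum' : ∑ i : Fin 3, ∑ j : Fin 3, CP * G = 9 * (CP * G) := by
      simp only [Finset.sum_const, Finset.card_univ, Fintype.card_fin]
      ring
    have h9' : ((3 : ℝ) ^ 2) ^ (q - 1) * 9 = (9 : ℝ) ^ q := by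
      rw [show (3 : ℝ) ^ 2 = 9 by norm_num, Real.rpow_sub (by norm_num : (0 : ℝ) < 9),
        Real.rpow_one]
      field_simp
    have h9q : 0 ≤ ((3 : ℝ) ^ 2) ^ (q - 1) := Real.rpow_nonneg (by norm_num) _
    calc Hq ≤ ((3 : ℝ) ^ 2) ^ (q - 1) *
          ∑ i : Fin 3, ∑ j : Fin 3, ∫ x, |partialDeriv i (partialDeriv j (p τ)) x| ^ q := by
          rw [hHq]; exact hH
      _ ≤ ((3 : ℝ) ^ 2) ^ (q - 1) * (9 * (CP * G)) := by
          rw [← hsum']; exact mul_le_mul_of_nonneg_left hsum h9q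
      _ ≤ ((3 : ℝ) ^ 2) ^ (q - 1) * (9 * (CP * (K₃ * M ^ q * Fε))) := by gcongr
      _ = (((3 : ℝ) ^ 2) ^ (q - 1) * 9) * CP * K₃ * M ^ q * Fε := by ring
      _ = (9 : ℝ) ^ q * CP * K₃ * M ^ q * Fε := by rw [h9']
  have h9 : 0 ≤ (9 : ℝ) ^ q * CP * K₃ := by positivity
  have hPle : |P| ≤ q / 2 * (((9 : ℝ) ^ q * CP * K₃) ^ (1 / q) * M * Fε) := by
    have h := abs_integral_reg_mul_le hut (continuous_hessAbs hpt) hh0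
      (fun x => abs_sum_strain_mul_le_sum_abs (u τ) x fun i j => partialDeriv i (partialDeriv j (p τ)) x)
      hε hq0.le
    rw [← hP] at h
    have h' := integral_rpow_mul_le_holder hφc (continuous_hessAbs hpt) (fun x => Real.sqrt_nonneg _)
      hh0 hq
    rw [hφq, ← hHq] at h'
    have h'' := holder_sup_chain hFε0 hHq0 h9 hM hq0 h' (by linarith [hHle])
    exact h.trans (mul_le_mul_of_nonneg_left h'' (by linarith))
  -- (iv) assemble: `2νV ≤ 0`, `−2P ≤ 2|P|`, `−2N ≤ 2|N|`
  have hVle : V ≤ 0 := by rw [hV]; exact viscous_reg_nonpos hut hε hq1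
  have hνV : 2 * ν * V ≤ 0 := mul_nonpos_of_nonneg_of_nonpos (by positivity) hVle
  have hP' : -P ≤ |P| := neg_le_abs P
  have hN' : -N ≤ |N| := neg_le_abs N
  nlinarith [hNle, hPle, hP', hN', hνV]

end StrainMoment

end Summit.NavierStokesRegularity.FunctionalMining

end
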